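import Mathlib
import HarnessLib

/-!
# Taylor coefficients of products and of compositions (formal = analytic)

`Literature/Analysis/Complex/TaylorCoefficientsAlgebra.lean`. Everything here is PROVED (no
definition, no named fact). For functions `f, g : ℂ → ℂ` that are `n` times continuously
differentiable at `c` (we work over `ℂ`), the normalized Taylor coefficients `u⁽ᵏ⁾(c)/k!` of
the product are the
Cauchy product of those of the factors (`taylorCoeff_mul`, from Mathlib's Leibniz rule
`iteratedDeriv_mul`); hence for functions analytic at `c` the formal power series
`∑ₙ (u⁽ⁿ⁾(c)/n!) Tⁿ ∈ ℂ⟦T⟧` of a product is the product of the formal power series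
(`taylorPowerSeries_mul`, stated with `PowerSeries.mk`), and likewise for powers and finite
products (`taylorPowerSeries_pow`, `taylorPowerSeries_prod`); and — the main result of §3 —
for `u, φ` analytic at `0` with `φ(0) = 0`, the Taylor power series of the composition `u ∘ φ` at
`0` is the formal substitution (`PowerSeries.subst`) of that of `φ` into that of `u`
(`taylorPowerSeries_comp`). This is the (folklore) dictionary
between germs of analytic functions and formal power series needed whenever an analytic estimate
of Taylor coefficients (Cauchy's inequality) is to be compared with a formal computation, e.g. in
F. Calegari, V. Dimitrov, Y. Tang, *The unbounded denominators conjecture* (J. Amer. Math. Soc.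
**38** (2025), 627–702), §2.2, where the lowest-order coefficient of
`H(z) = ∏ h(z_j)^D · F(φ(z₁), …, φ(z_d))` is computed formally and bounded by Cauchy's formula.
[folklore]
-/

noncomputable section

open Finset

namespace Literature.Analysis.Complex


/-- **Taylor coefficients of a product** (Leibniz): if `f, g` are `Cⁿ` at `c` then
`(fg)⁽ⁿ⁾(c)/n! = ∑_{i+j=n} (f⁽ⁱ⁾(c)/i!) (g⁽ʲ⁾(c)/j!)`. [folklore] -/
theorem taylorCoeff_mul {f g : ℂ → ℂ} {c : ℂ} {n : ℕ} (hf : ContDiffAt ℂ n f c)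
    (hg : ContDiffAt ℂ n g c) :
    iteratedDeriv n (f * g) c / n.factorial =
      ∑ ij ∈ antidiagonal n, iteratedDeriv ij.1 f c / ij.1.factorial *
        (iteratedDeriv ij.2 g c / ij.2.factorial) := by
  rw [iteratedDeriv_mul hf hg, Finset.Nat.sum_antidiagonal_eq_sum_range_succ_mk, sum_div]
  refine sum_congr rfl fun i hi ↦ ?_
  have hin : i ≤ n := Nat.lt_succ_iff.mp (mem_range.mp hi)
  have hfac : (n.factorial : ℂ) = n.choose i * i.factorial * (n - i).factorial := by
    have h := Nat.choose_mul_factorial_mul_factorial hin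
    exact_mod_cast h.symm
  have hi0 : (i.factorial : ℂ) ≠ 0 := by exact_mod_cast i.factorial_ne_zero
  have hni0 : ((n - i).factorial : ℂ) ≠ 0 := by exact_mod_cast (n - i).factorial_ne_zero
  have hc0 : (n.choose i : ℂ) ≠ 0 := by exact_mod_cast (Nat.choose_pos hin).ne'
  rw [hfac]
  field_simp

/-- The formal power series of Taylor coefficients at `c` of a product of functions analytic at
`c` is the product of the formal power series. [folklore] -/
theorem taylorPowerSeries_mul {f g : ℂ → ℂ} {c : ℂ} (hf : AnalyticAt ℂ f c)
    (hg : AnalyticAt ℂ g c) :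
    PowerSeries.mk (fun n ↦ iteratedDeriv n (f * g) c / n.factorial) =
      PowerSeries.mk (fun n ↦ iteratedDeriv n f c / n.factorial) *
        PowerSeries.mk (fun n ↦ iteratedDeriv n g c / n.factorial) := by
  ext n
  rw [PowerSeries.coeff_mk, PowerSeries.coeff_mul, taylorCoeff_mul hf.contDiffAt hg.contDiffAt]
  simp only [PowerSeries.coeff_mk]

/-- The constant function `1` has Taylor series `1`. [folklore] -/
theorem taylorPowerSeries_one (c : ℂ) :
    PowerSeries.mk (fun n ↦ iteratedDeriv n (1 : ℂ → ℂ) c / n.factorial) = 1 := by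
  ext n
  rw [PowerSeries.coeff_mk, PowerSeries.coeff_one, Pi.one_def, iteratedDeriv_const]
  by_cases hn : n = 0
  · subst hn; simp
  · simp [if_neg hn]

/-- Taylor power series of a finite product of functions analytic at `c`. [folklore] -/
theorem taylorPowerSeries_prod {ι : Type*} (s : Finset ι) {u : ι → ℂ → ℂ}
    {c : ℂ} (hu : ∀ i ∈ s, AnalyticAt ℂ (u i) c) :
    PowerSeries.mk (fun n ↦ iteratedDeriv n (∏ i ∈ s, u i) c / n.factorial) =
      ∏ i ∈ s, PowerSeries.mk (fun n ↦ iteratedDeriv n (u i) c / n.factorial) := by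
  classical
  induction s using Finset.induction_on with
  | empty => simpa using taylorPowerSeries_one c
  | insert a s has ih =>
    rw [prod_insert has, prod_insert has,
      taylorPowerSeries_mul (hu a (mem_insert_self a s))
        (Finset.analyticAt_prod s (fun i hi ↦ hu i (mem_insert_of_mem hi))),
      ih (fun i hi ↦ hu i (mem_insert_of_mem hi))]

/-- Taylor power series of a power of a function analytic at `c`. [folklore] -/
theorem taylorPowerSeries_pow {u : ℂ → ℂ} {c : ℂ} (hu : AnalyticAt ℂ u c)
    (k : ℕ) :
    PowerSeries.mk (fun n ↦ iteratedDeriv n (u ^ k) c / n.factorial) =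
      PowerSeries.mk (fun n ↦ iteratedDeriv n u c / n.factorial) ^ k := by
  induction k with
  | zero => simpa using taylorPowerSeries_one c
  | succ k ih => rw [pow_succ, pow_succ, taylorPowerSeries_mul (hu.pow k) hu, ih]

/-! ### 2. Linearity, units and congruence of the Taylor power series at `0` -/

/-- The Taylor power series at `0` only depends on the germ at `0`. [folklore] -/
theorem taylorPowerSeries_congr {u v : ℂ → ℂ} (h : u =ᶠ[nhds 0] v) :
    PowerSeries.mk (fun n ↦ iteratedDeriv n u 0 / n.factorial) =
      PowerSeries.mk (fun n ↦ iteratedDeriv n v 0 / n.factorial) := by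
  ext n
  rw [PowerSeries.coeff_mk, PowerSeries.coeff_mk, h.iteratedDeriv_eq]

/-- Additivity. [folklore] -/
theorem taylorPowerSeries_add {u v : ℂ → ℂ} (hu : AnalyticAt ℂ u 0) (hv : AnalyticAt ℂ v 0) :
    PowerSeries.mk (fun n ↦ iteratedDeriv n (u + v) 0 / n.factorial) =
      PowerSeries.mk (fun n ↦ iteratedDeriv n u 0 / n.factorial) +
        PowerSeries.mk (fun n ↦ iteratedDeriv n v 0 / n.factorial) := by
  ext n
  rw [map_add, PowerSeries.coeff_mk, PowerSeries.coeff_mk, PowerSeries.coeff_mk,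
    iteratedDeriv_add hu.contDiffAt hv.contDiffAt, add_div]

/-- Finite sums. [folklore] -/
theorem taylorPowerSeries_sum {ι : Type*} (s : Finset ι) {u : ι → ℂ → ℂ}
    (hu : ∀ i ∈ s, AnalyticAt ℂ (u i) 0) :
    PowerSeries.mk (fun n ↦ iteratedDeriv n (fun z ↦ ∑ i ∈ s, u i z) 0 / n.factorial) =
      ∑ i ∈ s, PowerSeries.mk (fun n ↦ iteratedDeriv n (u i) 0 / n.factorial) := by
  ext n
  rw [PowerSeries.coeff_mk, map_sum, iteratedDeriv_fun_sum (fun i hi ↦ (hu i hi).contDiffAt),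
    sum_div]
  simp only [PowerSeries.coeff_mk]

/-- Homogeneity: `𝓣(c · u) = c • 𝓣 u`. [folklore] -/
theorem taylorPowerSeries_const_mul {u : ℂ → ℂ} (c : ℂ) (hu : AnalyticAt ℂ u 0) :
    PowerSeries.mk (fun n ↦ iteratedDeriv n (fun z ↦ c * u z) 0 / n.factorial) =
      c • PowerSeries.mk (fun n ↦ iteratedDeriv n u 0 / n.factorial) := by
  ext n
  rw [PowerSeries.coeff_mk, PowerSeries.coeff_smul, PowerSeries.coeff_mk,
    iteratedDeriv_const_mul c hu.contDiffAt, smul_eq_mul, mul_div_assoc]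

/-- The monomial functions: `𝓣(z ↦ zⁱ) = Xⁱ`. [folklore] -/
theorem taylorPowerSeries_pow_id (i : ℕ) :
    PowerSeries.mk (fun n ↦ iteratedDeriv n (fun z : ℂ ↦ z ^ i) 0 / n.factorial) =
      PowerSeries.X ^ i := by
  ext n
  rw [PowerSeries.coeff_mk, PowerSeries.coeff_X_pow, iteratedDeriv_fun_pow_zero]
  by_cases hn : n = i
  · subst hn
    rw [if_pos rfl, if_pos rfl]
    have h0 : (n.factorial : ℂ) ≠ 0 := by exact_mod_cast n.factorial_ne_zero
    rw [div_self h0]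
  · rw [if_neg hn, if_neg hn, Nat.cast_zero, zero_div]

/-- The constant term of the Taylor power series is the value at `0`. [folklore] -/
theorem constantCoeff_taylorPowerSeries (u : ℂ → ℂ) :
    PowerSeries.constantCoeff (PowerSeries.mk (fun n ↦ iteratedDeriv n u 0 / n.factorial)) =
      u 0 := by
  rw [PowerSeries.constantCoeff_mk, iteratedDeriv_zero, Nat.factorial_zero, Nat.cast_one, div_one]

/-! ### 3. Composition with an analytic map fixing `0` is formal substitution -/

/-- Polynomials in `φ`: for `φ` analytic at `0` with `φ(0) = 0`,
`𝓣(∑_{i<N} aᵢ φⁱ) = (∑_{i<N} aᵢ Xⁱ)(𝓣 φ)` (formal substitution `PowerSeries.subst`). [folklore] -/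
theorem taylorPowerSeries_sum_mul_pow {φ : ℂ → ℂ} (hφ : AnalyticAt ℂ φ 0) (hφ0 : φ 0 = 0)
    (a : ℕ → ℂ) (N : ℕ) :
    PowerSeries.mk (fun n ↦ iteratedDeriv n (fun z ↦ ∑ i ∈ range N, a i * φ z ^ i) 0 /
        n.factorial) =
      PowerSeries.subst (PowerSeries.mk (fun n ↦ iteratedDeriv n φ 0 / n.factorial))
        (∑ i ∈ range N, a i • (PowerSeries.X : PowerSeries ℂ) ^ i) := by
  set T : PowerSeries ℂ := PowerSeries.mk (fun n ↦ iteratedDeriv n φ 0 / n.factorial) with hT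
  have hT0 : PowerSeries.constantCoeff T = 0 := by
    rw [hT, constantCoeff_taylorPowerSeries, hφ0]
  have hTs : PowerSeries.HasSubst T := PowerSeries.HasSubst.of_constantCoeff_zero' hT0
  -- left side: linearity and the power rule
  have hφi : ∀ i, AnalyticAt ℂ (fun z ↦ φ z ^ i) 0 := fun i ↦ hφ.pow i
  have hterm : ∀ i, AnalyticAt ℂ (fun z ↦ a i * φ z ^ i) 0 := fun i ↦
    analyticAt_const.mul (hφi i)
  rw [taylorPowerSeries_sum (range N) (u := fun i z ↦ a i * φ z ^ i) (fun i _ ↦ hterm i)]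
  rw [← PowerSeries.coe_substAlgHom hTs, map_sum]
  refine sum_congr rfl fun i _ ↦ ?_
  rw [map_smul, map_pow, PowerSeries.coe_substAlgHom hTs, PowerSeries.subst_X hTs,
    taylorPowerSeries_const_mul (a i) (hφi i)]
  congr 1
  have h := taylorPowerSeries_pow hφ i
  rw [← hT] at h
  have hfun : (fun z ↦ φ z ^ i) = φ ^ i := rfl
  rw [hfun, h]

/-- **Composition is substitution**: for `u` analytic at `0` and `φ` analytic at `0` with
`φ(0) = 0`, the Taylor power series at `0` of `u ∘ φ` is the formal substitution of the Taylor
power series of `φ` into that of `u`:  `𝓣(u ∘ φ) = (𝓣 u)(𝓣 φ)`. Proof: Taylor's formula with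
analytic remainder `u(w) = ∑_{i<N} (u⁽ⁱ⁾(0)/i!) wⁱ + w^N F(w)` (Mathlib's
`AnalyticAt.exists_eventuallyEq_sum_add_pow_mul`) reduces the coefficient of `Tⁿ`, `n < N`, to
the polynomial case, because both `𝓣(φ^N · F∘φ) = (𝓣 φ)^N 𝓣(F ∘ φ)` and the substitution of
`𝓣 φ` into `X^N · (⋯)` are divisible by `X^N`. [folklore] -/
theorem taylorPowerSeries_comp {u φ : ℂ → ℂ} (hu : AnalyticAt ℂ u 0) (hφ : AnalyticAt ℂ φ 0)
    (hφ0 : φ 0 = 0) :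
    PowerSeries.mk (fun n ↦ iteratedDeriv n (u ∘ φ) 0 / n.factorial) =
      PowerSeries.subst (PowerSeries.mk (fun n ↦ iteratedDeriv n φ 0 / n.factorial))
        (PowerSeries.mk (fun n ↦ iteratedDeriv n u 0 / n.factorial)) := by
  set T : PowerSeries ℂ := PowerSeries.mk (fun n ↦ iteratedDeriv n φ 0 / n.factorial) with hT
  have hT0 : PowerSeries.constantCoeff T = 0 := by
    rw [hT, constantCoeff_taylorPowerSeries, hφ0]
  have hTs : PowerSeries.HasSubst T := PowerSeries.HasSubst.of_constantCoeff_zero' hT0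
  have hXT : PowerSeries.X ∣ T := PowerSeries.X_dvd_iff.mpr hT0
  ext n
  set N := n + 1 with hN
  -- Taylor's formula with analytic remainder for `u` at `0`, to order `N`
  obtain ⟨F, hF, huF⟩ := hu.exists_eventuallyEq_sum_add_pow_mul N
  set a : ℕ → ℂ := fun i ↦ iteratedDeriv i u 0 / i.factorial with ha
  -- transported along `φ` (which tends to `0 = φ 0`)
  have hφt : Filter.Tendsto φ (nhds 0) (nhds 0) := by
    have h := hφ.continuousAt.tendsto
    rwa [hφ0] at h
  have hcomp : (u ∘ φ) =ᶠ[nhds 0]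
      ((fun z ↦ ∑ i ∈ range N, a i * φ z ^ i) + fun z ↦ φ z ^ N * F (φ z)) := by
    filter_upwards [hφt.eventually huF] with z hz
    rw [Function.comp_apply, hz, Pi.add_apply]
    congr 1
    refine sum_congr rfl fun i _ ↦ ?_
    rw [ha, smul_eq_mul]
    ring
  have hpoly : AnalyticAt ℂ (fun z ↦ ∑ i ∈ range N, a i * φ z ^ i) 0 :=
    Finset.analyticAt_fun_sum _ fun i _ ↦ analyticAt_const.mul (hφ.pow i)
  have hFφ : AnalyticAt ℂ (fun z ↦ F (φ z)) 0 := by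
    have hF' : AnalyticAt ℂ F (φ 0) := by rwa [hφ0]
    exact hF'.comp hφ
  have hrem : AnalyticAt ℂ (fun z ↦ φ z ^ N * F (φ z)) 0 := (hφ.pow N).mul hFφ
  rw [taylorPowerSeries_congr hcomp, taylorPowerSeries_add hpoly hrem, map_add,
    taylorPowerSeries_sum_mul_pow hφ hφ0 a N]
  -- the remainder term contributes nothing below degree `N`
  have hrem0 : PowerSeries.coeff n
      (PowerSeries.mk (fun k ↦ iteratedDeriv k (fun z ↦ φ z ^ N * F (φ z)) 0 / k.factorial)) =
        0 := by
    have hmul := taylorPowerSeries_mul (hφ.pow N) hFφ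
    have hpow := taylorPowerSeries_pow hφ N
    rw [← hT] at hpow
    have hdvd : PowerSeries.X ^ N ∣
        PowerSeries.mk (fun k ↦ iteratedDeriv k (fun z ↦ φ z ^ N * F (φ z)) 0 / k.factorial) := by
      have h1 : (fun z ↦ φ z ^ N * F (φ z)) = (φ ^ N) * (fun z ↦ F (φ z)) := by
        funext z; simp [Pi.mul_apply, Pi.pow_apply]
      rw [h1, hmul, show (PowerSeries.mk fun n ↦ iteratedDeriv n (φ ^ N) 0 / n.factorial) = T ^ N
        from hpow]
      exact Dvd.dvd.mul_right (pow_dvd_pow_of_dvd hXT N) _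
    exact (PowerSeries.X_pow_dvd_iff.mp hdvd) n (Nat.lt_succ_self n)
  rw [hrem0, add_zero]
  -- on the formal side, `𝓣 u` and its truncation agree modulo `X^N`
  have htrunc : PowerSeries.X ^ N ∣
      (PowerSeries.mk (fun k ↦ iteratedDeriv k u 0 / k.factorial) -
        ∑ i ∈ range N, a i • (PowerSeries.X : PowerSeries ℂ) ^ i) := by
    rw [PowerSeries.X_pow_dvd_iff]
    intro m hm
    rw [map_sub, PowerSeries.coeff_mk, map_sum, sub_eq_zero]
    simp only [map_smul, PowerSeries.coeff_X_pow, smul_eq_mul, mul_ite, mul_one, mul_zero]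
    rw [Finset.sum_ite_eq, if_pos (mem_range.mpr hm)]
  obtain ⟨G, hG⟩ := htrunc
  have hsplit : PowerSeries.mk (fun k ↦ iteratedDeriv k u 0 / k.factorial) =
      (∑ i ∈ range N, a i • (PowerSeries.X : PowerSeries ℂ) ^ i) + PowerSeries.X ^ N * G := by
    rw [← hG]; ring
  rw [hsplit, PowerSeries.subst_add hTs, map_add, PowerSeries.subst_mul hTs,
    PowerSeries.subst_pow hTs, PowerSeries.subst_X hTs]
  have hTN : PowerSeries.coeff n (T ^ N * PowerSeries.subst T G) = 0 :=
    (PowerSeries.X_pow_dvd_iff.mp (Dvd.dvd.mul_right (pow_dvd_pow_of_dvd hXT N) _)) n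
      (Nat.lt_succ_self n)
  rw [hTN, add_zero]

end Literature.Analysis.Complex
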